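import Mathlib
import HarnessLib
import Summits.QuantumFields.QCD.Theses.HeatSlicedQuarks
import Literature.MathematicalPhysics.QuantumLattice.WilsonFermionBlockAveraging

/-!
# Sketch — first lemmas of three crux ideas for `HeatSlicedQuarks.InterleavedHeatSliceFlow`
(stmt-QuantumFields-8891, crux-ideate round 1, ideator 3). Statements only (`def … : Prop`);
nothing here is proved. All constants `lean search`-ed: `wilsonDirac`, `fundamentalRep`,
`plaquetteHolonomy`, `GaugeConfig`, `TorusSite`, `spinorLift`, `gammaFive`, `gaugeRotation`,
`gaugeTransform`, `Matrix.IsHermitian.eigenvalues₀`.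
-/

namespace Summit.QuantumFields.QCD.Cruxes.InterleavedHeatSliceFlow.SketchIdeator3

open Literature.MathematicalPhysics.QuantumLattice Literature.MathematicalPhysics.QuantumFieldTheory
  Literature.Probability.LatticeModels
open scoped Matrix Kronecker

/-- `H_U(m) = D_W(U,m,1)† D_W(U,m,1)` for the fundamental `SU(3)` Wilson operator of the tree. -/
noncomputable abbrev H3 {L : ℕ} [NeZero L] (U : GaugeConfig 4 L (Matrix.specialUnitaryGroup (Fin 3) ℂ)) (m : ℝ) :
    Matrix (TorusSite 4 L × Fin 3 × Fin 4) (TorusSite 4 L × Fin 3 × Fin 4) ℂ :=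
  (wilsonDirac (fundamentalRep (Fin 3)) U m 1)ᴴ * wilsonDirac (fundamentalRep (Fin 3)) U m 1

/-- The free (all links `= 1`) `SU(3)` configuration. -/
abbrev freeConfig (L : ℕ) : GaugeConfig 4 L (Matrix.specialUnitaryGroup (Fin 3) ℂ) := fun _ => 1

/-! ## Card `pauli-pays-for-defect-modes` — first lemma -/

/-- **DefectMinorBound** (first lemma of `pauli-pays-for-defect-modes`): every `k × k` minor of a
complex `n × n` matrix `D` is bounded by the product of the `k` LARGEST singular values of `D`
(squared form: by the top-`k` eigenvalues of `Dᴴ D`, `eigenvalues₀` being sorted decreasingly).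
Unnormalised Berezin moments `∫ e^{-ψ̄Dψ} ∏_{i ≤ p} ψ̄ψ` are `(n-p)`-minors of `D`, so exact Grassmann
integration through a defect never produces an inverse small singular value: the small ones are
simply absent (Horn–Johnson 2012 Cor. 7.3.6, interlacing of singular values of submatrices). -/
def DefectMinorBound : Prop :=
  ∀ (n k : ℕ) (hk : k ≤ n) (D : Matrix (Fin n) (Fin n) ℂ) (s t : Fin k ↪ Fin n),
    ‖(D.submatrix s t).det‖ ^ 2 ≤
      ∏ i : Fin k, (Matrix.isHermitian_conjTranspose_mul_self D).eigenvalues₀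
        (Fin.cast (Fintype.card_fin n).symm (Fin.castLE hk i))

/-! ## Card `transported-parametrix-counterterms` — first lemma -/

/-- **ParametrixDiagonal** (first lemma of `transported-parametrix-counterterms`): under GLOBAL
scale-covariant smallness (all plaquette deficits `≤ (ε/r²)²`) the on-diagonal heat kernel of
`H_U = D_W†D_W` is the FREE one up to RELATIVE error `C ε t / r²` for `1 ≤ t ≤ r²` — identification,
not just the sup bound `C/t²` of `SmallFieldUltracontractivity`; the relative error is the flux
through the diffusion area (`|F|·t`), i.e. the first covariant heat-kernel coefficient — plus the
Gaussian winding tail `C e^{-c L²/t}/t²` of the torus (torons: flat connections with non-trivial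
holonomy have all deficits `0` yet shift the kernel at `t ≍ L²`; on the RG's tori `L = L_k ≫ √t`
this term is invisible). -/
def ParametrixDiagonal : Prop :=
  ∃ ε : ℝ, 0 < ε ∧ ∃ C c : ℝ, 0 < c ∧ ∀ (L : ℕ) [NeZero L]
    (U : GaugeConfig 4 L (Matrix.specialUnitaryGroup (Fin 3) ℂ)) (m : ℝ), m ∈ Set.Icc (-(1 / 2 : ℝ)) 1 →
    ∀ (r : ℕ), 1 ≤ r → r ≤ L →
    (∀ (y : TorusSite 4 L) (μ ν : Fin 4),
      3 - ((fundamentalRep (Fin 3)) (plaquetteHolonomy U y μ ν)).trace.re ≤ (ε / (r : ℝ) ^ 2) ^ 2) →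
    ∀ (t : ℝ), 1 ≤ t → t ≤ (r : ℝ) ^ 2 → ∀ (x : TorusSite 4 L) (a b : Fin 3) (α β : Fin 4),
      ‖(NormedSpace.exp (-(t : ℂ) • H3 U m)) (x, a, α) (x, b, β) -
          (NormedSpace.exp (-(t : ℂ) • H3 (freeConfig L) m)) (x, a, α) (x, b, β)‖ ≤
        C * (ε * t / (r : ℝ) ^ 2) / t ^ 2 + C * Real.exp (-(c * (L : ℝ) ^ 2 / t)) / t ^ 2

/-! ## Card `square-root-dissipativity-strips` — first lemmas -/

/-- **SquareDissipativity**: for `P` Hermitian and `a` anti-Hermitian with `‖a‖ ≤ c`,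
`Re ⟨v, (P + a)² v⟩ ≥ -c² ‖v‖²` — because `Re (P+a)² = P² + a²` and `a² ≥ -c²`. Hence
`‖exp(-s (P+a)²)‖ ≤ e^{s c²}` for all `s ≥ 0` (Lumer–Phillips): the complexified heat slice at proper
time `t` tolerates a non-Hermitian part of size `t^{-1/2}`, not `t^{-1}`. -/
def SquareDissipativity : Prop :=
  ∀ (ι : Type) [Fintype ι] [DecidableEq ι] (P a : Matrix ι ι ℂ) (c : ℝ),
    P.IsHermitian → aᴴ = -a →
    (∀ w : ι → ℂ, ∑ i, ‖a.mulVec w i‖ ^ 2 ≤ c ^ 2 * ∑ i, ‖w i‖ ^ 2) →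
    ∀ v : ι → ℂ,
      -(c ^ 2 * ∑ i, ‖v i‖ ^ 2) ≤ (∑ i, star (v i) * ((P + a) * (P + a)).mulVec v i).re

/-- **HolomorphicGaugeCovariance**: the holomorphic heat slice `exp(-t (Γ₅ D_W(U))²)` of the Wilson
operator over `GL(3,ℂ)`-valued links (the tree's `wilsonDirac` with `ρ = Units.coeHom`, backward hop
`ρ(U⁻¹)`) is conjugation-covariant under COMPLEX gauge transformations `g : Λ → GL(3,ℂ)` — complex
gauge directions of Bałaban's analyticity domains cost only `‖𝒢‖‖𝒢⁻¹‖`, uniformly in `t`. For unitary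
links `(Γ₅ D_W)² = D_W† D_W` by γ₅-hermiticity. -/
def HolomorphicGaugeCovariance : Prop :=
  ∀ (L : ℕ) [NeZero L] (g : TorusSite 4 L → Matrix.GeneralLinearGroup (Fin 3) ℂ)
    (U : GaugeConfig 4 L (Matrix.GeneralLinearGroup (Fin 3) ℂ)) (m : ℝ) (t : ℂ),
    NormedSpace.exp (-t • (spinorLift gammaFive *
        wilsonDirac (Units.coeHom (Matrix (Fin 3) (Fin 3) ℂ)) (gaugeTransform g U) m 1) ^ 2) =
      gaugeRotation (Units.coeHom (Matrix (Fin 3) (Fin 3) ℂ)) (Fin 4) g *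
        NormedSpace.exp (-t • (spinorLift gammaFive *
          wilsonDirac (Units.coeHom (Matrix (Fin 3) (Fin 3) ℂ)) U m 1) ^ 2) *
        gaugeRotation (Units.coeHom (Matrix (Fin 3) (Fin 3) ℂ)) (Fin 4) g⁻¹

end Summit.QuantumFields.QCD.Cruxes.InterleavedHeatSliceFlow.SketchIdeator3
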